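import Mathlib
import HarnessLib
import Literature.Analysis.FluidPDE.MillerMiddleEigenvalueSupPropagationSharp
import Summits.NavierStokesRegularity.NavierStokesRegularity.Theorems.PlaneStrainDoorTypeFreeRung

/-!
# nsreg-p1 ROUND-15 (planned door S16 «plane-strain window door»), rung (ii) on `ℝ³` with the SHARP threshold:
# `λ₂(∇u(t,x)) ≤ ε/(T−t)`, `ε < 1/4` ⇒ smooth extension past `T`

Twin of the tree's `PlaneStrainDoorTypeFreeRung` (`hasSmoothExtensionPast_of_middleEigenvalue_le_typeI`, `ε < 1/8`) with
Miller's sharp enstrophy constant: for a classical solution of the unforced Navier–Stokes system on `ℝ³ × [0,T)` which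
is Leray–Hopf on `[0,T)` and whose MIDDLE principal strain obeys `λ₂(∇u(t,x)) ≤ ε/(T−t)` (two-frame Courant–Fischer
form) for all `(t,x) ∈ [0,T) × ℝ³` with `0 ≤ ε < 1/4`:

* `hasSmoothExtensionPast_of_middleEigenvalue_le_typeI_sharp` — **the rung**: `HasSmoothExtensionPast ν 0 u T`;
* `typeFreeMidStrainRung_one_quarter` — the TEXT of nsreg-p1's `r15/Sketch16.lean` `TypeFreeMidStrainRung (1/4)`
  (`MidStrainMajorant` unfolded; majorant only on `[a,T) × ℝ³` for some `a ∈ [0,T)`): restart at a good Leray–Hopf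
  time in `(a,T)` and glue, exactly as the tree's `typeFreeMidStrainRung_one_eighth`.

Proof of the rung: verbatim the tree's, with the sharp propagation `eWeakGradL2Sq_le_exp_two_of_midStrain_sup`
(`‖∇u(s)‖² ≤ ((T/2)/(T−s))^{2ε} ‖∇u(T/2)‖²`, from Miller's `∂ₜ‖∇u‖² ≤ 2λ₂⁺‖∇u‖²`, i.e. the isometry
`‖∇u‖² = 2‖S‖²`) in place of the `4ε` one: Leray's local `H¹` lifespan from `u(s)` is `≳ (T−s)^{4ε}`, which beats
`T − s` near `T` iff `4ε < 1`.  This matches the TORUS rung `PlaneStrainDoorTypeFreeRungTorus` (`ε < 1/4`) and is the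
natural endpoint of the `H¹`-restart method (`E ≲ (T−t)^{-2ε}` versus Leray's necessary rate `E ≳ (T−t)^{-1/2}`).
Seat nsreg-p6 g8 (anchor `--supports stmt-NavierStokesRegularity-11719` per DIRECTOR-NS g6 #13, as the `1/8` file).
WHAT THIS IS NOT: not NS regularity (Clay A) — an explicit-constant CONDITIONAL continuation criterion; not the planned
door S16 itself (whose window form is local in space); not a route open.
-/

noncomputable section

open MeasureTheory Set Function Filter Topology InnerProductSpace
open scoped ENNReal NNReal ContDiff RealInnerProductSpace
open Literature.Analysis Literature.Analysis.FluidPDE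

-- the summit and its single sub-problem share the name (CONVENTIONS §1), as in every Theorems file
set_option linter.dupNamespace false

namespace Summit.NavierStokesRegularity.NavierStokesRegularity.Theorems.PlaneStrainDoorTypeFreeRungSharp

open Summit.NavierStokesRegularity.NavierStokesRegularity.Theorems.PlaneStrainDoorTypeFreeRung

/-- **The type-free rung on `ℝ³`, sharp threshold** (nsreg-p1 ROUND-15 rung (ii), Miller's constant): a classical
Leray–Hopf solution on `ℝ³ × [0,T)` with `λ₂(∇u(t,x)) ≤ ε/(T−t)` (two-frame form) for all `t ∈ [0,T)`, `x ∈ ℝ³`, and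
`0 ≤ ε < 1/4`, extends to a classical solution past `T`. -/
theorem hasSmoothExtensionPast_of_middleEigenvalue_le_typeI_sharp {ν T ε : ℝ} (hν : 0 < ν) (hT : 0 < T)
    (hε0 : 0 ≤ ε) (hε : ε < 1 / 4)
    {u : ℝ → EuclideanSpace ℝ (Fin 3) → EuclideanSpace ℝ (Fin 3)} {p : ℝ → EuclideanSpace ℝ (Fin 3) → ℝ}
    (hcl : IsClassicalNSSolutionOn (Ico 0 T) ν 0 u p) (hLH : IsLerayHopfOn T ν 0 (u 0) u)
    (hmaj : ∀ t ∈ Ico 0 T, ∀ x, ∃ v w : EuclideanSpace ℝ (Fin 3), ‖v‖ = 1 ∧ ‖w‖ = 1 ∧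
      ⟪v, w⟫ = 0 ∧ ∀ α β : ℝ,
        ⟪fderiv ℝ (u t) x (α • v + β • w), α • v + β • w⟫ ≤ ε / (T - t) * (α ^ 2 + β ^ 2)) :
    HasSmoothExtensionPast ν 0 u T := by
  -- the nonnegative time-only majorant `m = max (ε/(T−t)) 0`
  set m : ℝ → ℝ := fun t => max (ε / (T - t)) 0 with hm
  have hm0 : ∀ t, 0 ≤ m t := fun t => le_max_right _ _
  have hmT : ∀ t < T, m t = ε / (T - t) := fun t ht => max_eq_left (div_nonneg hε0 (sub_pos.2 ht).le)
  have hmaj' : ∀ t ∈ Ico 0 T, ∀ x, ∃ v w : EuclideanSpace ℝ (Fin 3), ‖v‖ = 1 ∧ ‖w‖ = 1 ∧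
      ⟪v, w⟫ = 0 ∧ ∀ α β : ℝ,
        ⟪fderiv ℝ (u t) x (α • v + β • w), α • v + β • w⟫ ≤ m t * (α ^ 2 + β ^ 2) := by
    intro t ht x
    rw [hmT t ht.2]
    exact hmaj t ht x
  have hlin : ∀ a b, 0 ≤ a → a ≤ b → b < T →
      ∫⁻ σ in Ioo a b, ENNReal.ofReal (m σ) = ENNReal.ofReal (ε * Real.log ((T - a) / (T - b))) := by
    intro a b _ hab hbT
    rw [← lintegral_Ioo_eps_div hε0 hab hbT]
    refine setLIntegral_congr_fun measurableSet_Ioo fun σ hσ => ?_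
    rw [hmT σ (hσ.2.trans hbT)]
  have hA : ∀ b < T, ∫⁻ t in Ioo 0 b, ENNReal.ofReal (m t) ≠ ⊤ := by
    intro b hb
    rcases le_or_gt b 0 with hb0 | hb0
    · rw [Ioo_eq_empty (not_lt.2 hb0), Measure.restrict_empty, lintegral_zero_measure]
      exact ENNReal.zero_ne_top
    · rw [hlin 0 b le_rfl hb0.le hb]
      exact ENNReal.ofReal_ne_top
  -- `H¹`-regularity on `(0, T)` and the sharp propagation from `t₀ = T/2`
  have hreg : IsH1RegularOn (Ioo 0 T) u := isH1RegularOn_Ioo_of_midStrain_sup hν hT hLH hcl hm0 hmaj' hA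
  obtain ⟨c, hc, hL2⟩ := tao2011_H1_local_almost_regular_holds
  set t₀ : ℝ := T / 2 with ht₀
  have ht₀m : t₀ ∈ Ioo 0 T := ⟨by rw [ht₀]; linarith, by rw [ht₀]; linarith⟩
  set y₀ : ℝ≥0∞ := eWeakGradL2Sq (u t₀) with hy₀
  have hy₀top : y₀ ≠ ⊤ := (lt_of_le_of_lt le_add_self (hreg.eH1NormSq_lt_top ht₀m)).ne
  set Y : ℝ := y₀.toReal with hY
  have hY0 : 0 ≤ Y := ENNReal.toReal_nonneg
  set KE : ℝ := 2 * VectorCalculus.kineticEnergy (u 0) with hKE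
  -- the `H¹` majorant `a(s) = max KE 0 + ((T/2)/(T−s))^{2ε} Y` on `[T/2, T)`
  set a : ℝ → ℝ := fun s => max KE 0 + ((T / 2) / (T - s)) ^ (2 * ε) * Y with ha
  have ha0 : ∀ s, s < T → 0 ≤ a s := fun s hs =>
    add_nonneg (le_max_right _ _) (mul_nonneg (Real.rpow_nonneg (div_pos (half_pos hT) (sub_pos.2 hs)).le _) hY0)
  have hH1 : ∀ s ∈ Ico t₀ T, eH1NormSq (u s) ≤ ENNReal.ofReal (a s) := by
    intro s hs
    have hsT : s < T := hs.2
    have hgrad := eWeakGradL2Sq_le_exp_two_of_midStrain_sup hL2 hc hν hLH hcl hm0 hmaj' hA le_rfl le_rfl hreg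
      ht₀m hs
    rw [hlin t₀ s ht₀m.1.le hs.1 hsT] at hgrad
    have hr : 0 < (T / 2) / (T - s) := div_pos (half_pos hT) (sub_pos.2 hsT)
    have hr1 : 1 ≤ (T / 2) / (T - s) := by
      rw [le_div_iff₀ (sub_pos.2 hsT), one_mul]; rw [ht₀] at hs; linarith [hs.1]
    have hTt₀ : T - t₀ = T / 2 := by rw [ht₀]; ring
    have hlog0 : 0 ≤ ε * Real.log (T / 2 / (T - s)) := mul_nonneg hε0 (Real.log_nonneg hr1)
    rw [hTt₀, ENNReal.toReal_ofReal hlog0, show 2 * (ε * Real.log (T / 2 / (T - s))) =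
      Real.log (T / 2 / (T - s)) * (2 * ε) by ring, ← Real.rpow_def_of_pos hr] at hgrad
    have hr0 : 0 ≤ (T / 2 / (T - s)) ^ (2 * ε) := Real.rpow_nonneg hr.le _
    calc eH1NormSq (u s) ≤ ENNReal.ofReal KE + ENNReal.ofReal ((T / 2 / (T - s)) ^ (2 * ε)) * y₀ :=
          add_le_add (hLH.eEnergy_le_datum hν.le ⟨ht₀m.1.le.trans hs.1, hsT.le⟩) hgrad
      _ ≤ ENNReal.ofReal (max KE 0) + ENNReal.ofReal ((T / 2 / (T - s)) ^ (2 * ε) * Y) := by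
          refine add_le_add (ENNReal.ofReal_le_ofReal (le_max_left _ _)) (le_of_eq ?_)
          rw [ENNReal.ofReal_mul hr0, hY, ENNReal.ofReal_toReal hy₀top]
      _ = ENNReal.ofReal (a s) := by
          rw [ha, ENNReal.ofReal_add (le_max_right _ _) (mul_nonneg hr0 hY0)]
  -- Leray's local `H¹` theory, LPS representatives
  obtain ⟨c', hc', hlocc⟩ := leray_local_strong_H1_holds
  have hLPS : ladyzhenskaya_prodi_serrin := ladyzhenskaya_prodi_serrin_holds
  have hcν : 0 < c' * ν ^ 3 := mul_pos hc' (pow_pos hν 3)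
  -- the size of the window near `T` in which the lifespan beats `T − s`
  set A₀ : ℝ := max KE 0 + Y with hA₀
  have hA₀0 : 0 ≤ A₀ := add_nonneg (le_max_right _ _) hY0
  set M : ℝ := A₀ ^ 2 * (T / 2) ^ (4 * ε) with hM
  have hM0 : 0 ≤ M := by positivity
  set γ : ℝ := 1 - 4 * ε with hγ
  have hγ0 : 0 < γ := by rw [hγ]; linarith
  set κ : ℝ := c' * ν ^ 3 / (2 * (M + 1)) with hκ
  have hκ0 : 0 < κ := by positivity
  set δ₀ : ℝ := κ ^ (1 / γ) with hδ₀
  have hδ₀pos : 0 < δ₀ := Real.rpow_pos_of_pos hκ0 _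
  have hδ₀γ : δ₀ ^ γ = κ := by
    rw [hδ₀, ← Real.rpow_mul hκ0.le, one_div_mul_cancel hγ0.ne', Real.rpow_one]
  set δ₁ : ℝ := min δ₀ (min (c' * ν ^ 3 / 4) (T / 2)) with hδ₁
  have hδ₁pos : 0 < δ₁ := lt_min hδ₀pos (lt_min (by positivity) (half_pos hT))
  have hδ₁0 : δ₁ ≤ δ₀ := min_le_left _ _
  have hδ₁c : δ₁ ≤ c' * ν ^ 3 / 4 := (min_le_right _ _).trans (min_le_left _ _)
  have hδ₁T : δ₁ ≤ T / 2 := (min_le_right _ _).trans (min_le_right _ _)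
  -- a good restart time `s ∈ (T − δ₁, T)`
  set s₀ : ℝ := T - δ₁ with hs₀
  have hs₀0 : 0 ≤ s₀ := by rw [hs₀]; linarith
  have hs₀T : s₀ < T := by rw [hs₀]; linarith
  obtain ⟨s, hs, hLHs⟩ := hLH.exists_isLerayHopfOn_restart_Ioo hν.le hs₀0 hs₀T le_rfl
  have hsT2 : t₀ ≤ s := by rw [ht₀]; rw [hs₀] at hs; linarith [hs.1]
  have hs0 : 0 < s := ht₀m.1.trans_le hsT2
  have hTs : 0 < T - s := sub_pos.2 hs.2
  set δ : ℝ := T - s with hδ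
  have hδ1 : δ < δ₁ := by rw [hδ]; rw [hs₀] at hs; linarith [hs.1]
  -- the `H¹` size at `s` and Leray's lifespan
  set as : ℝ := a s with has
  have has0 : 0 ≤ as := ha0 s hs.2
  set τ : ℝ := c' * ν ^ 3 / (as ^ 2 + 1) with hτ
  have hτpos : 0 < τ := div_pos hcν (by positivity)
  have hτc : as ^ 2 * τ ≤ c' * ν ^ 3 := by
    have h1 : as ^ 2 * τ = c' * ν ^ 3 * (as ^ 2 / (as ^ 2 + 1)) := by rw [hτ]; ring
    rw [h1]
    exact mul_le_of_le_one_right hcν.le (div_le_one_of_le₀ (by linarith) (by positivity))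
  -- KEY: the lifespan beats `T − s` since `4ε < 1`
  have hsτ : T < s + τ := by
    -- `as ≤ A₀ r^{2ε}`, `r = (T/2)/δ ≥ 1`
    have hr : 0 < (T / 2) / δ := div_pos (half_pos hT) hTs
    have hr1 : 1 ≤ (T / 2) / δ := by
      rw [le_div_iff₀ hTs, one_mul]; linarith [hδ1, hδ₁T]
    have hr4 : 1 ≤ ((T / 2) / δ) ^ (2 * ε) := Real.one_le_rpow hr1 (by linarith)
    have hasle : as ≤ A₀ * ((T / 2) / δ) ^ (2 * ε) := by
      rw [has, ha, hA₀]; simp only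
      rw [add_mul]
      refine add_le_add ?_ (le_of_eq (mul_comm _ _))
      exact le_mul_of_one_le_right (le_max_right _ _) hr4
    -- `δ · as² ≤ M δ^γ`
    have hsq : as ^ 2 ≤ A₀ ^ 2 * (((T / 2) / δ) ^ (2 * ε)) ^ 2 := by
      rw [← mul_pow]; exact pow_le_pow_left₀ has0 hasle 2
    have hr8 : (((T / 2) / δ) ^ (2 * ε)) ^ 2 = (T / 2) ^ (4 * ε) * δ ^ (-(4 * ε)) := by
      rw [sq, ← Real.rpow_add hr, show 2 * ε + 2 * ε = 4 * ε by ring,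
        Real.div_rpow (half_pos hT).le hTs.le, Real.rpow_neg hTs.le, div_eq_mul_inv]
    have hδγ : δ * δ ^ (-(4 * ε)) = δ ^ γ := by
      rw [hγ, sub_eq_add_neg, Real.rpow_add hTs, Real.rpow_one]
    have hmain : δ * as ^ 2 ≤ M * δ ^ γ := by
      calc δ * as ^ 2 ≤ δ * (A₀ ^ 2 * ((T / 2) ^ (4 * ε) * δ ^ (-(4 * ε)))) := by
            rw [← hr8]; exact mul_le_mul_of_nonneg_left hsq hTs.le
        _ = M * δ ^ γ := by rw [hM, ← hδγ]; ring
    -- `δ^γ ≤ κ`, so `δ (as² + 1) < c'ν³`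
    have hδγle : δ ^ γ ≤ κ := by
      rw [← hδ₀γ]; exact Real.rpow_le_rpow hTs.le (hδ1.le.trans hδ₁0) hγ0.le
    have hMκ : M * κ ≤ c' * ν ^ 3 / 2 := by
      have hM1 : (M + 1) ≠ 0 := by positivity
      have h1 : M * κ = c' * ν ^ 3 / 2 * (M / (M + 1)) := by
        rw [hκ]; field_simp
      rw [h1]
      exact mul_le_of_le_one_right (by positivity) (div_le_one_of_le₀ (by linarith) (by positivity))
    have hlt : δ * (as ^ 2 + 1) < c' * ν ^ 3 := by
      have h1 : δ * (as ^ 2 + 1) = δ * as ^ 2 + δ := by ring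
      rw [h1]
      have h2 : δ < c' * ν ^ 3 / 4 := hδ1.trans_le hδ₁c
      have h3 := mul_le_mul_of_nonneg_left hδγle hM0
      linarith [hmain, h3, hMκ, h2, hcν]
    have hδτ : δ < τ := by
      rw [hτ, lt_div_iff₀ (by positivity)]; exact hlt
    have hδτ' : T - s < τ := by rw [hδ] at hδτ; exact hδτ
    linarith [hδτ']
  have hTsτ : T - s ≤ τ := by linarith
  -- the datum `u s ∈ H¹` with `‖u(s)‖²_{H¹} ≤ as`
  have hu2 : MemLp (u s) 2 volume := hLH.memLp s ⟨hs0.le, hs.2.le⟩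
  have hdiv : IsWeaklyDivFree (u s) := hLHs.isWeaklyDivFree_datum hTs
  have hgrad : eWeakGradL2Sq (u s) ≤ ENNReal.ofReal as :=
    le_add_self.trans (hH1 s ⟨hsT2, hs.2⟩)
  -- Leray's local strong solution `v` from `u s` on `[0, τ]` (RRS Thm. 6.15)
  obtain ⟨v, hv, hv0, hvreg⟩ := hlocc hν hτpos hu2 hdiv has0 hgrad hτc
  -- its classical representative `(V, P)` on `(0, τ]` (RRS Thm. 8.17, first clause, `L^∞_t L⁶_x`)
  have hvS : MemLqLp ∞ 6 v (Ioo 0 τ) :=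
    memLqLp_top_six_of_isH1RegularOn_Icc hvreg fun t ht => hv.memLp t ht
  have hr6 : (3 : ℝ≥0∞) < 6 := by norm_num
  have hqr6 : 2 / (∞ : ℝ≥0∞) + 3 / (6 : ℝ≥0∞) ≤ 1 := by
    rw [ENNReal.div_top, zero_add]
    exact ENNReal.div_le_of_le_mul (by norm_num)
  obtain ⟨V, P, hVP, hvV⟩ := hLPS hν hτpos hv hr6 hqr6 hvS
  -- weak–strong uniqueness on `[0, T - s)`: `u (t + s) = v t` a.e., `0 < t ≤ T - s`
  have hae : ∀ t ∈ Ioc 0 (T - s), (fun t => u (t + s)) t =ᵐ[volume] v t :=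
    serrin_weak_strong_uniqueness_holds hν hTs (hv.of_le hTsτ) hu2 (q := ∞) (r := 6) hr6
      hqr6 (hvS.mono_set (Ioo_subset_Ioo_right hTsτ)) hLHs
  -- everywhere agreement of the continuous slices on `(s, T)`
  have heq : ∀ t ∈ Ioo s T, u t = V (t + -s) := by
    intro t ht
    have hts : t - s ∈ Ioc 0 (T - s) := ⟨sub_pos.2 ht.1, by linarith [ht.2]⟩
    have h1 : u t =ᵐ[volume] v (t - s) := by
      have h := hae (t - s) hts
      simpa only [sub_add_cancel] using h
    have h2 : v (t - s) =ᵐ[volume] V (t - s) := hvV (t - s) ⟨hts.1, hts.2.trans hTsτ⟩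
    have hcu : Continuous (u t) :=
      (hcl.contDiff_velocity ⟨hs0.le.trans ht.1.le, ht.2⟩).continuous
    have hcV : Continuous (V (t - s)) :=
      (hVP.contDiff_velocity ⟨hts.1, hts.2.trans hTsτ⟩).continuous
    rw [← sub_eq_add_neg]
    exact (Continuous.ae_eq_iff_eq volume hcu hcV).1 (h1.trans h2)
  -- the continuation piece `(V, P)(· - s)` on `(s, s + τ)`
  have h₂ : IsClassicalNSSolutionOn (Ioo s (s + τ)) ν 0 (fun t => V (t + -s))
      (fun t => P (t + -s)) := by
    have hVP' := hVP.comp_add_right (-s)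
    have h0 : (fun t => (0 : ℝ → EuclideanSpace ℝ (Fin 3) → EuclideanSpace ℝ (Fin 3)) (t + -s)) = 0 :=
      rfl
    rw [h0] at hVP'
    exact hVP'.mono (fun t ht => ⟨by simp only [mem_Ioo] at ht ⊢; linarith [ht.1],
      by simp only [mem_Ioo] at ht ⊢; linarith [ht.2]⟩) isOpen_Ioo.uniqueDiffOn
  -- glue along the overlap `(s, T)`
  exact ⟨s + τ, hsτ, _, _, hcl.glue h₂ hs0.le hs.2 hsτ.le heq, fun t ht => by
    simp only [if_pos ht.2]⟩

/-- **rung L0 `TypeFreeMidStrainRung (1/4)`** (text of nsreg-p1 `r15/Sketch16.lean` at the SHARP constant `ε₀ = 1/4`,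
`MidStrainMajorant` unfolded): a classical Leray–Hopf solution from rapidly decaying data with `λ₂(∇u(t,x)) ≤ ε/(T−t)`
on `[a,T) × ℝ³` for some `a ∈ [0,T)` and `0 ≤ ε < 1/4` extends smoothly past `T`.  (The rapid-decay hypothesis is not
used.) -/
theorem typeFreeMidStrainRung_one_quarter :
    ∀ (ν T : ℝ), 0 < ν → 0 < T → ∀ (u : ℝ → EuclideanSpace ℝ (Fin 3) → EuclideanSpace ℝ (Fin 3))
      (p : ℝ → EuclideanSpace ℝ (Fin 3) → ℝ),
    IsClassicalNSSolutionOn (Set.Ico 0 T) ν 0 u p →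
    IsLerayHopfOn T ν 0 (u 0) u →
    HasRapidSpatialDecay (u 0) →
    ∀ ε : ℝ, 0 ≤ ε → ε < 1 / 4 → ∀ a ∈ Set.Ico 0 T,
    (∀ t ∈ Set.Ico a T, ∀ x, ∃ v w : EuclideanSpace ℝ (Fin 3), ‖v‖ = 1 ∧ ‖w‖ = 1 ∧ inner ℝ v w = 0 ∧
      ∀ α β : ℝ, inner ℝ (fderiv ℝ (u t) x (α • v + β • w)) (α • v + β • w) ≤ ε / (T - t) * (α ^ 2 + β ^ 2)) →
    HasSmoothExtensionPast ν 0 u T := by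
  intro ν T hν hT u p hcl hLH _ ε hε0 hε a ha hmaj
  -- a good restart time `s₁ ∈ (a, T)`
  obtain ⟨s₁, hs₁, hLHs⟩ := hLH.exists_isLerayHopfOn_restart_Ioo hν.le ha.1 ha.2 le_rfl
  have hs₁0 : 0 ≤ s₁ := ha.1.trans hs₁.1.le
  have hTs : 0 < T - s₁ := sub_pos.2 hs₁.2
  -- the shifted solution `U t = u (t + s₁)` on `[0, T - s₁)`
  set U : ℝ → EuclideanSpace ℝ (Fin 3) → EuclideanSpace ℝ (Fin 3) := fun t => u (t + s₁) with hU
  have hclU : IsClassicalNSSolutionOn (Ico 0 (T - s₁)) ν 0 U (fun t => p (t + s₁)) := by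
    have h := hcl.comp_add_right s₁
    have h0 : (fun t => (0 : ℝ → EuclideanSpace ℝ (Fin 3) → EuclideanSpace ℝ (Fin 3)) (t + s₁)) = 0 := rfl
    rw [h0] at h
    exact h.mono (fun t ht => by
      simp only [mem_Ico] at ht ⊢; constructor <;> linarith [ht.1, ht.2]) (uniqueDiffOn_Ico 0 _)
  have hLHU : IsLerayHopfOn (T - s₁) ν 0 (U 0) U := by
    have : U 0 = u s₁ := by simp [hU]
    rw [this]; exact hLHs
  have hmajU : ∀ t ∈ Ico 0 (T - s₁), ∀ x, ∃ v w : EuclideanSpace ℝ (Fin 3), ‖v‖ = 1 ∧ ‖w‖ = 1 ∧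
      ⟪v, w⟫ = 0 ∧ ∀ α β : ℝ,
        ⟪fderiv ℝ (U t) x (α • v + β • w), α • v + β • w⟫ ≤ ε / (T - s₁ - t) * (α ^ 2 + β ^ 2) := by
    intro t ht x
    have ht' : t + s₁ ∈ Ico a T := ⟨by linarith [ht.1, hs₁.1], by linarith [ht.2]⟩
    have e1 : T - s₁ - t = T - (t + s₁) := by ring
    rw [e1]
    exact hmaj (t + s₁) ht' x
  -- extension of the shifted solution past `T - s₁`
  obtain ⟨T'', hT'', U', P', hU', hagree⟩ :=
    hasSmoothExtensionPast_of_middleEigenvalue_le_typeI_sharp hν hTs hε0 hε hclU hLHU hmajU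
  -- shift back and glue along `(s₁, T)`
  have h₂ : IsClassicalNSSolutionOn (Ioo s₁ (s₁ + T'')) ν 0 (fun t => U' (t + -s₁)) (fun t => P' (t + -s₁)) := by
    have h := hU'.comp_add_right (-s₁)
    have h0 : (fun t => (0 : ℝ → EuclideanSpace ℝ (Fin 3) → EuclideanSpace ℝ (Fin 3)) (t + -s₁)) = 0 := rfl
    rw [h0] at h
    exact h.mono (fun t ht => by
      simp only [mem_Ioo] at ht ⊢; constructor <;> linarith [ht.1, ht.2])
      isOpen_Ioo.uniqueDiffOn
  have heq : ∀ t ∈ Ioo s₁ T, u t = U' (t + -s₁) := by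
    intro t ht
    have h1 : t + -s₁ ∈ Ico 0 (T - s₁) := ⟨by linarith [ht.1], by linarith [ht.2]⟩
    rw [hagree _ h1, hU]
    simp
  have hTb : T ≤ s₁ + T'' := by linarith
  exact ⟨s₁ + T'', by linarith, _, _, hcl.glue h₂ hs₁0 hs₁.2 hTb heq, fun t ht => by simp only [if_pos ht.2]⟩

end Summit.NavierStokesRegularity.NavierStokesRegularity.Theorems.PlaneStrainDoorTypeFreeRungSharp

end
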